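import Literature.MathematicalPhysics.QuantumFieldTheory.Balaban1983to89.B9Ineq386RightEntry
import Literature.MathematicalPhysics.QuantumFieldTheory.Balaban1983to89.B9Thm37Sum

/-!
# `Balaban1983to89.B9Ineq386CommSum` — B9 pp. 404–407, (3.70)–(3.73) and (3.84)–(3.86): the commutator device of
# `B9Ineq386RightEntry` §5 for the PRINTED FINITE SUM `Σ_{ν=1}^d` (`V₃ = V⁰ + Σ_k V¹_k∇_k`, one commutator letter per
# difference letter), and the block-majorant DICTIONARY for range-one local letters

statement-level skeleton of published theorems with citation tags; proofs where landed; nothing here is a claim about the Yang–Mills mass gap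

CITATION HEADER (lean-in-tree rule).  T. Bałaban, *Propagators for lattice gauge theories in a background field*, Commun.
Math. Phys. **99** (1985) 389–434 [Balaban1985BackgroundPropagators] (cell paper B9; `paper:balaban1985-cmp99-background-
propagators`, journal page = PDF page + 388): p. 404–405 [PDF 16–17] (3.70)–(3.73) («Σ_{ν=1}^d [ … iad_{A_ν(x)}(D_νA′_μ)(x) −
iad_{A_μ(x)}(D_μA′_ν)(x) … ]», «The derivatives are, of course, the covariant derivatives defined by U»), p. 407 [PDF 19]
(3.84)–(3.86), p. 397–398 [PDF 9–10] (3.42) and the remarks after Theorem 3.1, p. 396 [PDF 8] (3.37); [4] = T. Bałaban,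
*Propagators and renormalization transformations for lattice gauge theories. II*, Commun. Math. Phys. **96** (1984)
223–250 [Balaban1984PropagatorsII], (2.51)–(2.55) p. 232 («A summation preserves it also»), Lemma 2.1 p. 234, (2.66)
p. 234.  Renders `b2b-balaban-ref1/pages/1985-cmp99-background-propagators/…-p016/p017/p019-x2.png` read as images by this
seat's lineage (gen 7) and p. 400 [PDF 12] re-read by this seat (gen 8).  Cell `lit-balaban`, seat r06 (B9 fold owner)
gen 8; SKELETON rows **B9.Eq3.85** (× B9.Thm3.4) and **B9.Eq3.70/3.73**.  Sibling of the same seat's `B9Eq352DivForm`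
(same gen: the commutator letters IDENTIFIED on the concrete carrier, where they come one per bond of `st(x)`).

WHY THIS FILE.  `B9Ineq385VG.ineq385_op` ((3.85)) and `B9Ineq386RightEntry` §3–§5 ((3.42)₃ for `G(U′U)`) read the
first-order operator `V₃ = V₁ + V₂` of (3.70)–(3.75) through ONE difference letter, `V₃ = V⁰ + V¹·∇`, and — for the right
entry — ONE commutator letter `[V¹, ∇]`.  In print `V₁(A)A′`, `V₂(A)A′` are SUMS over the directions `ν = 1, …, d` (and
over the two orientations of the bonds of `st(x)`) of terms «coefficient `iad_A` × covariant difference of the argument»,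
each with ITS OWN difference letter `∇_ν`, `∇*_ν`; the concrete identification (`B9Eq352DivForm.commPart`) accordingly
produces one commutator letter `ad_{∇_νA}∘τ_ν` per difference letter.  This module supplies the abstract side in exactly
that shape: the gradient form `V₃ = V⁰ + Σ_{k∈s} V¹_k∇_k` over a finite index set, commutator letters `[V¹_k, ∇_k]`,
entries `∇_kG(U)`, `G(U)∇_k` of Theorem 3.3 per letter («we may always replace ∇_U by ∇*_U», p. 398), with the SAME
constants `κ₃₈₅` as the one-letter files once `Σ_k c_k ≦ c_V` ([4] p. 232: «A summation preserves it also»).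

WHAT THIS FILE PROVES (theorems only; 0 sorry; no definitions, no `Prop` placeholders; standard axioms).  SETTING as in
`B9Ineq385VG`/`B9Ineq386RightEntry`: pv08's `B6RandomWalk.HasMajorant` over `B9Thm34Ext.toB6`, all letters in ONE
`Module.End ℝ (W → ℝ)` with block map `blk : W → 𝔅`.
* §1 **`hasMajorant_of_local`** — THE DICTIONARY FOR RANGE-ONE LOCAL LETTERS ([4] (2.51) shape): if `(Tμ)(x)` is
  controlled by the values of `μ` on a stencil `near x ·` whose blocks lie within `d`-distance `d₀` of the block of `x`,
  `|Tμ(x)| ≦ c(y)·sup_{near x} |μ|`, then `T ≺ c(y)e^{δd₀}e^{−δd(y,y′)}` for every `δ ≧ 0` — how a pointwise bound of a local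
  lattice operator (a coefficient `iad_A(x)`, a transported shift `τ_ν`, a commutator letter `ad_{∇A(x)}∘τ_ν` of
  `B9Eq352DivForm`, sizes `(Lʲη)⁻¹α₁`, `1`, `(Lʲη)⁻²α₁`) becomes a letter of the block-majorant calculus; `hasMajorant_of_local'`
  (the same with the stencil inside one block: block-diagonal majorant `c(y)·𝟙[y = y′]`).
* §2 THE FINITE-SUM DEVICE: `divForm_of_gradForm_sum` (ring identity `V⁰ + Σ_k V¹_k∇_k = Σ_k ∇_kV¹_k + (V⁰ + Σ_k [V¹_k,
  ∇_k])`), `hasMajorant_sum_const` (majorants of a finite sum with a common shape add their constants),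
  `hasMajorant_C₃_of_comm_sum` (`V⁰ + Σ_k [V¹_k, ∇_k] ≺ (c_V + Σ_k c_{K,k})α₁(Lʲη)⁻²e^{−δd}`), **`ineq385_op_sum`** ((3.85) for
  `V₃ = V⁰ + Σ_k V¹_k∇_k`: `V(A)G(U) ≺ κ₃₈₅α₁e^{−ρd}`, constant `B9Ineq385VG.kappa385` UNCHANGED given `Σ_k c_{1,k} ≦ c_V`),
  **`hasMajorant_GV_of_divForm_sum`** (the left composite `G(U)V(A) ≺ κ₃₈₅α₁e^{−ρd}` from the divergence form `V₃ = Σ_k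
  ∇♯_kB_k + C₃`), **`hasMajorant_GV_of_gradForm_comm_sum`** (the same from the gradient form plus the commutator letters,
  constant `κ₃₈₅` with `c_V + Σ_k c_{K,k}` for `c_V`), and **`thm34_G_entries13_opForm_of_comm_sum`** — Theorem 3.4's
  `G`-part, entries (3.42)₁ AND (3.42)₃ for one and the same two-sided inverse `G(U′U)` of `Δ_a(U′U)`, from the finite-sum
  gradient form, the per-letter entries and commutators, under ONE smallness condition `κ₃₈₅(c_V + Σc_K)α₁c₁ < 1` — the
  statement of `B9Ineq386RightEntry.thm34_G_entries13_opForm_of_comm` with `Σ_k` throughout.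

HONEST SCOPE / NOT CLAIMED.  (i) Operator (block `L^∞ → L^∞`) form throughout, as the files it extends.  (ii) §1 is a
dictionary over an ABSTRACT carrier `W` with a stencil relation; instantiating it on the concrete `𝔸`-valued lattice of
`B9Eq352DivForm` still requires real coordinates of 𝔤 (the cell's kernel-dictionary seam, p06 g5 `B9Ineq3137From149`
«NOT bridged») — not done here.  (iii) The (3.68)₃,₄ side (`B9Ineq368PPrimeDs` §5, the `G′`-chain with `V′`) consumes the
structure of `V′` only through the sub-word `G′V′G′(U′U)D*` (`hasMajorant_GVEDs`); its finite-sum form is the same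
bookkeeping and is NOT restated here.  (iv) Nothing about the concrete `V₁`, `V₂`, `V′` is asserted; rates/weights as in
`B9Ineq386RightEntry` (iii).  Value = the printed `Σ_{ν=1}^d` made explicit in the abstract Sect. B chain, so that the
per-direction letters of the concrete identification are consumable as filed; NOT summit progress.

RELATED IN THE TREE, NOT DUPLICATED (searched 2026-08-21: `lean search hasMajorant_finsetSum` = `B9Thm37Sum` (used BY
NAME), `B6Prop26Gluing`; `ls Balaban1983to89 | grep -i CommSum` = ∅): `B9Ineq385VG.ineq385_op`, `B9Ineq386RightEntry`
§3–§5 (one-letter forms, whose downstream theorems `gExt_entry1_of_386`, `gExt_rightEntry_of_386L` and gen 2's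
`B9Eq360Vprime.exists_gPrimeExt_of_363` are used BY NAME for the assembly), `B9Ineq366CPrime.hasMajorant_local_mul`
(block-DIAGONAL letters only; §1 here covers stencils reaching into neighbouring blocks).
-/

noncomputable section

namespace Literature.MathematicalPhysics.QuantumFieldTheory.Balaban1983to89.B9Ineq386CommSum

open Literature.MathematicalPhysics.QuantumFieldTheory.Balaban1983to89
open Literature.MathematicalPhysics.QuantumFieldTheory.Balaban1983to89.B6RandomWalk (HasMajorant BlockSupp
  hasMajorant_mono hasMajorant_mul hasMajorant_add Triangle254 Ineq261)
open Literature.MathematicalPhysics.QuantumFieldTheory.Balaban1983to89.B9Thm34Ext (toB6)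
open Literature.MathematicalPhysics.QuantumFieldTheory.Balaban1983to89.B9Ineq347 (ScaleTransfer)
open Literature.MathematicalPhysics.QuantumFieldTheory.Balaban1983to89.B9Ineq366CPrime (hasMajorant_comp_decay
  hasMajorant_rate_mono)
open Literature.MathematicalPhysics.QuantumFieldTheory.Balaban1983to89.B9Eq386Neumann (pTwo vTotal)
open Literature.MathematicalPhysics.QuantumFieldTheory.Balaban1983to89.B9Ineq385VG (kappa385 kappa385_nonneg
  gExt_entry1_of_386)
open Literature.MathematicalPhysics.QuantumFieldTheory.Balaban1983to89.B9Ineq386RightEntry (gExt_rightEntry_of_386L)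
open Literature.MathematicalPhysics.QuantumFieldTheory.Balaban1983to89.B9Thm37Sum (hasMajorant_finsetSum)

/-! ## §1  Range-one local letters have block majorants (the dictionary) -/

section Local

variable {g : B9.Geometry} [Fintype g.Site] {R : ℝ} {H : Prop} {W : Type}

/-- **Dictionary: a local letter is a letter of the block-majorant calculus.**  Let `T` be controlled by a stencil: for every
`μ`, `x` and `B`, if `|μ(x′)| ≦ B` at all stencil points `x′` of `x` then `|(Tμ)(x)| ≦ c(y)·B`, `y` the block of `x` (`c ≧ 0`),
and let every stencil point of `x` lie in a block at `d`-distance `≦ d₀` from the block of `x`.  Then for every `δ ≧ 0`,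
`|(Tμ)(x)| ≦ c(y)e^{δd₀}·e^{−δd(y,y′)}|μ|` for `x ∈ Δ(y)`, `supp μ ⊂ Δ(y′)` — the shape (2.51) of [4].  (If no stencil point of `x`
meets `Δ(y′)`, `Tμ(x) = 0`; otherwise `d(y,y′) ≦ d₀`.)
[cite: Balaban1984PropagatorsII, (2.51) p.232; Balaban1985BackgroundPropagators, (3.73) p.405 + (3.37) p.396] -/
theorem hasMajorant_of_local (blk : W → g.Site) (near : W → W → Prop) (c : g.Site → ℝ) (d₀ δ : ℝ)
    (hc : ∀ a, 0 ≤ c a) (hδ : 0 ≤ δ) (hnear : ∀ x x', near x x' → g.dist (blk x) (blk x') ≤ d₀)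
    {T : Module.End ℝ (W → ℝ)}
    (hT : ∀ (μ : W → ℝ) (x : W) (B : ℝ), (∀ x', near x x' → |μ x'| ≤ B) → |T μ x| ≤ c (blk x) * B) :
    HasMajorant (g := toB6 g R H) blk T
      (fun a b => c a * Real.exp (δ * d₀) * Real.exp (-(δ * g.dist a b))) := by
  intro y' μ B hμ x
  by_cases hx : ∃ x', near x x' ∧ blk x' = y'
  · obtain ⟨x', hxx', hx'y⟩ := hx
    have hB : ∀ x'', near x x'' → |μ x''| ≤ B := fun x'' _ => by
      by_cases hb : blk x'' = y'
      · exact hμ.bound x'' hb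
      · rw [hμ.off x'' hb, abs_zero]; exact hμ.nonneg
    have h1 : |T μ x| ≤ c (blk x) * B := hT μ x B hB
    have hd : g.dist (blk x) y' ≤ d₀ := by rw [← hx'y]; exact hnear x x' hxx'
    have he : 1 ≤ Real.exp (δ * d₀) * Real.exp (-(δ * g.dist (blk x) y')) := by
      rw [← Real.exp_add]
      exact Real.one_le_exp (by nlinarith)
    calc |T μ x| ≤ c (blk x) * 1 * B := by simpa using h1
      _ ≤ c (blk x) * (Real.exp (δ * d₀) * Real.exp (-(δ * g.dist (blk x) y'))) * B := by
          have hcB : 0 ≤ c (blk x) * B := mul_nonneg (hc _) hμ.nonneg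
          nlinarith
      _ = c (blk x) * Real.exp (δ * d₀) * Real.exp (-(δ * g.dist (blk x) y')) * B := by ring
  · have hx' : ∀ x'', near x x'' → blk x'' ≠ y' := fun x'' hn hb => hx ⟨x'', hn, hb⟩
    have hB : ∀ x'', near x x'' → |μ x''| ≤ 0 := fun x'' hn => by rw [hμ.off x'' (hx' x'' hn), abs_zero]
    have h1 : |T μ x| ≤ c (blk x) * 0 := hT μ x 0 hB
    have h0 : 0 ≤ c (blk x) * Real.exp (δ * d₀) * Real.exp (-(δ * g.dist (blk x) y')) * B :=
      mul_nonneg (mul_nonneg (mul_nonneg (hc _) (Real.exp_nonneg _)) (Real.exp_nonneg _)) hμ.nonneg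
    calc |T μ x| ≤ c (blk x) * 0 := h1
      _ = 0 := mul_zero _
      _ ≤ _ := h0

/-- **Block-local letters** (stencil inside the block of `x`: `Q′(U)` of (3.19), `F′₂(A)` of (3.59), a pointwise coefficient
`iad_{A(x)}`): `T ≺ c(y)·𝟙[y = y′]` — the block-diagonal shape consumed by `B9Ineq366CPrime.hasMajorant_local_mul`.
[cite: Balaban1984PropagatorsII, (2.51) p.232; Balaban1985BackgroundPropagators, (3.19) p.394 + (3.59) p.402] -/
theorem hasMajorant_of_local' [DecidableEq g.Site] (blk : W → g.Site) (near : W → W → Prop) (c : g.Site → ℝ)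
    (hnear : ∀ x x', near x x' → blk x' = blk x)
    {T : Module.End ℝ (W → ℝ)}
    (hT : ∀ (μ : W → ℝ) (x : W) (B : ℝ), (∀ x', near x x' → |μ x'| ≤ B) → |T μ x| ≤ c (blk x) * B) :
    HasMajorant (g := toB6 g R H) blk T (fun a b : g.Site => if a = b then c a else 0) := by
  intro y' μ B hμ x
  by_cases hx : blk x = y'
  · have hB : ∀ x'', near x x'' → |μ x''| ≤ B := fun x'' hn => hμ.bound x'' ((hnear x x'' hn).trans hx)
    have h1 : |T μ x| ≤ c (blk x) * B := hT μ x B hB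
    have e : (fun a b : g.Site => if a = b then c a else 0) (blk x) y' = c (blk x) := by simp [hx]
    rw [e]; exact h1
  · have hB : ∀ x'', near x x'' → |μ x''| ≤ 0 := fun x'' hn => by
      have hb : blk x'' ≠ y' := fun h => hx ((hnear x x'' hn).symm.trans h)
      rw [hμ.off x'' hb, abs_zero]
    have h1 : |T μ x| ≤ c (blk x) * 0 := hT μ x 0 hB
    have e : (fun a b : g.Site => if a = b then c a else 0) (blk x) y' = 0 := by simp [hx]
    rw [e, zero_mul]
    simpa using h1

end Local

/-! ## §2  The commutator device for the printed finite sum `Σ_{ν=1}^d` -/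

section SumDevice

variable {g : B9.Geometry} [Fintype g.Site] {R : ℝ} {H : Prop} {W : Type} {K : Type}

/-- **Lattice Leibniz rule, letter form, summed**: `V⁰ + Σ_{k∈s} V¹_k∇_k = Σ_{k∈s} ∇_kV¹_k + (V⁰ + Σ_{k∈s} (V¹_k∇_k −
∇_kV¹_k))` (ring identity; the content is in the sizes of the commutators). [cite: Balaban1985BackgroundPropagators, (3.70)–(3.71) pp.404–405 + (3.74)–(3.75) p.406] -/
theorem divForm_of_gradForm_sum (s : Finset K) {V₃ V0 : Module.End ℝ (W → ℝ)} {V1 D : K → Module.End ℝ (W → ℝ)}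
    (hV₃ : V₃ = V0 + ∑ k ∈ s, V1 k * D k) :
    V₃ = ∑ k ∈ s, D k * V1 k + (V0 + ∑ k ∈ s, (V1 k * D k - D k * V1 k)) := by
  rw [hV₃, Finset.sum_sub_distrib]
  abel

/-- **«A summation preserves it also»** ([4] p. 232) with a common shape: if `T_k ≺ c_k·w` for `k ∈ s` then `Σ_{k∈s} T_k ≺
(Σ_{k∈s} c_k)·w` (`B9Thm37Sum.hasMajorant_finsetSum` BY NAME). [cite: Balaban1984PropagatorsII, (2.52)–(2.55) p.232] -/
theorem hasMajorant_sum_const (blk : W → g.Site) (s : Finset K) (c : K → ℝ) (w : g.Site → g.Site → ℝ)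
    {T : K → Module.End ℝ (W → ℝ)}
    (h : ∀ k ∈ s, HasMajorant (g := toB6 g R H) blk (T k) (fun a b => c k * w a b)) :
    HasMajorant (g := toB6 g R H) blk (∑ k ∈ s, T k) (fun a b => (∑ k ∈ s, c k) * w a b) := by
  refine hasMajorant_mono (g := toB6 g R H) blk
    (hasMajorant_finsetSum (G := toB6 g R H) blk s T (fun k a b => c k * w a b) h) fun a b => le_of_eq ?_
  rw [Finset.sum_mul]

/-- **The zeroth-order letter of the divergence form, summed**: `V⁰ ≺ c_Vα₁(Lʲη)⁻²e^{−δd}` ((3.73)) and commutator letters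
`V¹_k∇_k − ∇_kV¹_k ≺ c_{K,k}α₁(Lʲη)⁻²e^{−δd}` ((3.37) sizes of the coefficient differences) give `V⁰ + Σ_k [V¹_k, ∇_k] ≺ (c_V +
Σ_k c_{K,k})α₁(Lʲη)⁻²e^{−δd}`. [cite: Balaban1985BackgroundPropagators, (3.73) p.405 + (3.37) p.396; Balaban1984PropagatorsII, (2.52) p.232] -/
theorem hasMajorant_C₃_of_comm_sum (blk : W → g.Site) (s : Finset K) (δ cV α₁ : ℝ) (cK : K → ℝ)
    {V0 : Module.End ℝ (W → ℝ)} {V1 D : K → Module.End ℝ (W → ℝ)}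
    (hV0 : HasMajorant (g := toB6 g R H) blk V0
      (fun a b => cV * α₁ * (g.len a ^ 2)⁻¹ * Real.exp (-(δ * g.dist a b))))
    (hComm : ∀ k ∈ s, HasMajorant (g := toB6 g R H) blk (V1 k * D k - D k * V1 k)
      (fun a b => cK k * α₁ * (g.len a ^ 2)⁻¹ * Real.exp (-(δ * g.dist a b)))) :
    HasMajorant (g := toB6 g R H) blk (V0 + ∑ k ∈ s, (V1 k * D k - D k * V1 k))
      (fun a b => (cV + ∑ k ∈ s, cK k) * α₁ * (g.len a ^ 2)⁻¹ * Real.exp (-(δ * g.dist a b))) := by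
  have hS := hasMajorant_sum_const (R := R) (H := H) blk s cK
    (fun a b => α₁ * (g.len a ^ 2)⁻¹ * Real.exp (-(δ * g.dist a b)))
    (T := fun k => V1 k * D k - D k * V1 k)
    (fun k hk => hasMajorant_mono (g := toB6 g R H) blk (hComm k hk) fun a b => le_of_eq (by ring))
  refine hasMajorant_mono (g := toB6 g R H) blk (hasMajorant_add (g := toB6 g R H) blk hV0 hS) fun a b => le_of_eq ?_
  ring

/-- **(3.85) for the printed finite sum** — «Using the bounds (3.73), (3.77), (3.83) and assuming that Theorem 3.3 holds for
G(U), we get |(V(A)G(U)J)(b)| ≦ O(1)α₁e^{−(1/2)δ₀d(y,y′)}|J|»: the hypotheses of `B9Ineq385VG.ineq385_op` with the gradient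
form `V₃ = V⁰ + Σ_{k∈s} V¹_k∇_k`, sizes `V¹_k ≺ c_{1,k}α₁(Lʲη)⁻¹e^{−δd}` with `Σ_k c_{1,k} ≦ c_V`, and Theorem 3.3's entry (3.42)₂
`∇_kG ≺ B₀Lʲη e^{−δd}` for each letter.  CONCLUSION unchanged: `V(A)G(U) ≺ κ₃₈₅·α₁·e^{−ρd}`, `κ₃₈₅ = B₀Λc(2c_V + κ₁ + κ₂) =
B9Ineq385VG.kappa385` — the words `V⁰G`, `V¹_k(∇_kG)` (`k ∈ s`), `P₁G`, `P₂G`.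
[cite: Balaban1985BackgroundPropagators, (3.84)–(3.85) p.407 + (3.70)–(3.73) pp.404–405 + (3.77) p.406 + (3.83) p.407 + Thm 3.3 p.399 + (3.42) p.397; Balaban1984PropagatorsII, Lemma 2.1 p.234 + (2.52)–(2.55) p.232] -/
theorem ineq385_op_sum (blk : W → g.Site) (d : ℕ) (s : Finset K) (δ₀ δ α β ρ Λ B₀ cV κ₁ κ₂ α₁ : ℝ) (c1 : K → ℝ)
    (hB₀ : 0 ≤ B₀) (hcV : 0 ≤ cV) (hκ₁ : 0 ≤ κ₁) (hκ₂ : 0 ≤ κ₂) (hα₁ : 0 ≤ α₁) (hΛ : 0 ≤ Λ) (hρ : 0 ≤ ρ)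
    (hα : 0 ≤ α) (hβ : 0 ≤ β) (hδ₀ : 0 ≤ δ₀) (hr : ρ + (α + β) * δ₀ ≤ δ)
    (hc1 : ∀ k ∈ s, 0 ≤ c1 k) (hsum : ∑ k ∈ s, c1 k ≤ cV)
    (hdnn : ∀ a b : g.Site, 0 ≤ g.dist a b) (htri : Triangle254 (toB6 g R H)) (hlen : ∀ y : g.Site, 0 < g.len y)
    (h261 : Ineq261 d (toB6 g R H) δ₀ β)
    (hT1 : ScaleTransfer g δ₀ α Λ (fun a => g.len a)) (hT2 : ScaleTransfer g δ₀ α Λ (fun a => g.len a ^ 2))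
    {G V₃ V0 P₁ P₂ : Module.End ℝ (W → ℝ)} {V1 D : K → Module.End ℝ (W → ℝ)} (hV₃ : V₃ = V0 + ∑ k ∈ s, V1 k * D k)
    (hV0 : HasMajorant (g := toB6 g R H) blk V0
      (fun a b => cV * α₁ * (g.len a ^ 2)⁻¹ * Real.exp (-(δ * g.dist a b))))
    (hV1 : ∀ k ∈ s, HasMajorant (g := toB6 g R H) blk (V1 k)
      (fun a b => c1 k * α₁ * (g.len a)⁻¹ * Real.exp (-(δ * g.dist a b))))
    (hP₁ : HasMajorant (g := toB6 g R H) blk P₁ (fun a b => κ₁ * α₁ * (g.len a ^ 2)⁻¹ * Real.exp (-(δ * g.dist a b))))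
    (hP₂ : HasMajorant (g := toB6 g R H) blk P₂ (fun a b => κ₂ * α₁ * (g.len a ^ 2)⁻¹ * Real.exp (-(δ * g.dist a b))))
    (hG : HasMajorant (g := toB6 g R H) blk G (fun a b => B₀ * g.len a ^ 2 * Real.exp (-(δ * g.dist a b))))
    (hDG : ∀ k ∈ s, HasMajorant (g := toB6 g R H) blk (D k * G)
      (fun a b => B₀ * g.len a * Real.exp (-(δ * g.dist a b)))) :
    HasMajorant (g := toB6 g R H) blk (vTotal V₃ P₁ P₂ * G)
      (fun a b => kappa385 B₀ cV κ₁ κ₂ Λ (B6.c1 d δ₀ β) * α₁ * Real.exp (-(ρ * g.dist a b))) := by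
  set c : ℝ := B6.c1 d δ₀ β with hc_def
  have hc0 : 0 ≤ c := B6RandomWalk.c1_nonneg d δ₀ β
  have hw1 : ∀ a : g.Site, 0 ≤ g.len a := fun a => (hlen a).le
  have hw2 : ∀ a : g.Site, 0 ≤ g.len a ^ 2 := fun a => sq_nonneg _
  have hw1i : ∀ a : g.Site, 0 ≤ (g.len a)⁻¹ := fun a => inv_nonneg.mpr (hlen a).le
  have hw2i : ∀ a : g.Site, 0 ≤ (g.len a ^ 2)⁻¹ := fun a => inv_nonneg.mpr (sq_nonneg _)
  have hcVα : 0 ≤ cV * α₁ := mul_nonneg hcV hα₁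
  have hκ₁α : 0 ≤ κ₁ * α₁ := mul_nonneg hκ₁ hα₁
  have hκ₂α : 0 ≤ κ₂ * α₁ := mul_nonneg hκ₂ hα₁
  have hρδ : ρ ≤ δ := by
    have : 0 ≤ (α + β) * δ₀ := by positivity
    linarith
  -- rate-weakened right letters
  have hGρ := hasMajorant_rate_mono (R := R) (H := H) blk B₀ (fun a => g.len a ^ 2) hB₀ hw2 hρδ hdnn hG
  -- the words V⁰G, P₁G, P₂G
  have w1 := hasMajorant_comp_decay (R := R) (H := H) blk d δ₀ α β ρ δ Λ (cV * α₁) B₀ (fun a => (g.len a ^ 2)⁻¹)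
    (fun a => g.len a ^ 2) hw2i hw2 hΛ hcVα hB₀ hρ hr hdnn htri hT2 h261 hV0 hGρ
  have w3 := hasMajorant_comp_decay (R := R) (H := H) blk d δ₀ α β ρ δ Λ (κ₁ * α₁) B₀ (fun a => (g.len a ^ 2)⁻¹)
    (fun a => g.len a ^ 2) hw2i hw2 hΛ hκ₁α hB₀ hρ hr hdnn htri hT2 h261 hP₁ hGρ
  have w4 := hasMajorant_comp_decay (R := R) (H := H) blk d δ₀ α β ρ δ Λ (κ₂ * α₁) B₀ (fun a => (g.len a ^ 2)⁻¹)
    (fun a => g.len a ^ 2) hw2i hw2 hΛ hκ₂α hB₀ hρ hr hdnn htri hT2 h261 hP₂ hGρ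
  -- the words V¹_k(∇_kG), summed
  have w2k : ∀ k ∈ s, HasMajorant (g := toB6 g R H) blk (V1 k * (D k * G))
      (fun a b => (c1 k * α₁ * B₀ * Λ * c) * (((g.len a)⁻¹ * g.len a) * Real.exp (-(ρ * g.dist a b)))) := by
    intro k hk
    have hDGρ := hasMajorant_rate_mono (R := R) (H := H) blk B₀ (fun a => g.len a) hB₀ hw1 hρδ hdnn (hDG k hk)
    have h := hasMajorant_comp_decay (R := R) (H := H) blk d δ₀ α β ρ δ Λ (c1 k * α₁) B₀ (fun a => (g.len a)⁻¹)
      (fun a => g.len a) hw1i hw1 hΛ (mul_nonneg (hc1 k hk) hα₁) hB₀ hρ hr hdnn htri hT1 h261 (hV1 k hk) hDGρ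
    exact hasMajorant_mono (g := toB6 g R H) blk h fun a b => le_of_eq (by rw [← hc_def]; ring)
  have w2 := hasMajorant_sum_const (R := R) (H := H) blk s (fun k => c1 k * α₁ * B₀ * Λ * c)
    (fun a b => ((g.len a)⁻¹ * g.len a) * Real.exp (-(ρ * g.dist a b))) w2k
  have hsum' := hasMajorant_add (g := toB6 g R H) blk
    (hasMajorant_add (g := toB6 g R H) blk (hasMajorant_add (g := toB6 g R H) blk w1 w2) w3) w4
  have e : vTotal V₃ P₁ P₂ * G = V0 * G + (∑ k ∈ s, V1 k * (D k * G)) + P₁ * G + P₂ * G := by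
    rw [vTotal, hV₃]
    simp only [add_mul, Finset.sum_mul, mul_assoc]
  rw [e]
  refine hasMajorant_mono (g := toB6 g R H) blk hsum' fun a b => ?_
  have ha : g.len a ≠ 0 := (hlen a).ne'
  have h1 : (g.len a)⁻¹ * g.len a = 1 := inv_mul_cancel₀ ha
  have h2 : (g.len a ^ 2)⁻¹ * g.len a ^ 2 = 1 := inv_mul_cancel₀ (pow_ne_zero 2 ha)
  have hS : (∑ k ∈ s, c1 k * α₁ * B₀ * Λ * c) ≤ cV * α₁ * B₀ * Λ * c := by
    rw [← Finset.sum_mul, ← Finset.sum_mul, ← Finset.sum_mul, ← Finset.sum_mul]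
    have : 0 ≤ α₁ * B₀ * Λ * c := by positivity
    have := mul_le_mul_of_nonneg_right hsum this
    nlinarith
  have hE : 0 ≤ Real.exp (-(ρ * g.dist a b)) := Real.exp_nonneg _
  simp only [kappa385]
  rw [h1, h2] at *
  nlinarith [mul_le_mul_of_nonneg_right hS hE]

/-- **`G(U)V(A) ≺ κ₃₈₅·α₁·e^{−ρd}` from the divergence form, summed** — the hypotheses of
`B9Ineq386RightEntry.hasMajorant_GV_of_divForm` with `V₃ = Σ_{k∈s} ∇♯_kB_k + C₃`, `B_k ≺ c_{B,k}α₁(Lʲη)⁻¹e^{−δd}`, `Σ_k c_{B,k} ≦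
c_V`, `C₃ ≺ c_Vα₁(Lʲη)⁻²e^{−δd}` and the entry `G(U)∇♯_k ≺ B₀Lʲη e^{−δd}` per letter: the words `(G∇♯_k)B_k` (`k ∈ s`), `GC₃`,
`GP₁`, `GP₂`; constant `κ₃₈₅` unchanged.
[cite: Balaban1985BackgroundPropagators, (3.84)–(3.86) p.407 + (3.70)–(3.73) pp.404–405 + (3.77) p.406 + (3.83) p.407 + Thm 3.3 p.399 + (3.42) p.397 + p.398 (remarks); Balaban1984PropagatorsII, Lemma 2.1 p.234 + (2.52)–(2.55) p.232] -/
theorem hasMajorant_GV_of_divForm_sum (blk : W → g.Site) (d : ℕ) (s : Finset K)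
    (δ₀ δ α β ρ Λ B₀ cV κ₁ κ₂ α₁ : ℝ) (cB : K → ℝ)
    (hB₀ : 0 ≤ B₀) (hcV : 0 ≤ cV) (hκ₁ : 0 ≤ κ₁) (hκ₂ : 0 ≤ κ₂) (hα₁ : 0 ≤ α₁) (hΛ : 0 ≤ Λ) (hρ : 0 ≤ ρ)
    (hα : 0 ≤ α) (hβ : 0 ≤ β) (hδ₀ : 0 ≤ δ₀) (hr : ρ + (α + β) * δ₀ ≤ δ)
    (hcB : ∀ k ∈ s, 0 ≤ cB k) (hsum : ∑ k ∈ s, cB k ≤ cV)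
    (hdnn : ∀ a b : g.Site, 0 ≤ g.dist a b) (htri : Triangle254 (toB6 g R H)) (hlen : ∀ y : g.Site, 0 < g.len y)
    (h261 : Ineq261 d (toB6 g R H) δ₀ β)
    (hT1i : ScaleTransfer g δ₀ α Λ (fun a => (g.len a)⁻¹)) (hT2i : ScaleTransfer g δ₀ α Λ (fun a => (g.len a ^ 2)⁻¹))
    {G V₃ C₃ P₁ P₂ : Module.End ℝ (W → ℝ)} {Dv B : K → Module.End ℝ (W → ℝ)} (hV₃div : V₃ = ∑ k ∈ s, Dv k * B k + C₃)
    (hB : ∀ k ∈ s, HasMajorant (g := toB6 g R H) blk (B k)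
      (fun a b => cB k * α₁ * (g.len a)⁻¹ * Real.exp (-(δ * g.dist a b))))
    (hC₃ : HasMajorant (g := toB6 g R H) blk C₃
      (fun a b => cV * α₁ * (g.len a ^ 2)⁻¹ * Real.exp (-(δ * g.dist a b))))
    (hP₁ : HasMajorant (g := toB6 g R H) blk P₁ (fun a b => κ₁ * α₁ * (g.len a ^ 2)⁻¹ * Real.exp (-(δ * g.dist a b))))
    (hP₂ : HasMajorant (g := toB6 g R H) blk P₂ (fun a b => κ₂ * α₁ * (g.len a ^ 2)⁻¹ * Real.exp (-(δ * g.dist a b))))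
    (hG : HasMajorant (g := toB6 g R H) blk G (fun a b => B₀ * g.len a ^ 2 * Real.exp (-(δ * g.dist a b))))
    (hGDv : ∀ k ∈ s, HasMajorant (g := toB6 g R H) blk (G * Dv k)
      (fun a b => B₀ * g.len a * Real.exp (-(δ * g.dist a b)))) :
    HasMajorant (g := toB6 g R H) blk (G * vTotal V₃ P₁ P₂)
      (fun a b => kappa385 B₀ cV κ₁ κ₂ Λ (B6.c1 d δ₀ β) * α₁ * Real.exp (-(ρ * g.dist a b))) := by
  set c : ℝ := B6.c1 d δ₀ β with hc_def
  have hc0 : 0 ≤ c := B6RandomWalk.c1_nonneg d δ₀ β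
  have hw1 : ∀ a : g.Site, 0 ≤ g.len a := fun a => (hlen a).le
  have hw2 : ∀ a : g.Site, 0 ≤ g.len a ^ 2 := fun a => sq_nonneg _
  have hw1i : ∀ a : g.Site, 0 ≤ (g.len a)⁻¹ := fun a => inv_nonneg.mpr (hlen a).le
  have hw2i : ∀ a : g.Site, 0 ≤ (g.len a ^ 2)⁻¹ := fun a => inv_nonneg.mpr (sq_nonneg _)
  have hcVα : 0 ≤ cV * α₁ := mul_nonneg hcV hα₁
  have hκ₁α : 0 ≤ κ₁ * α₁ := mul_nonneg hκ₁ hα₁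
  have hκ₂α : 0 ≤ κ₂ * α₁ := mul_nonneg hκ₂ hα₁
  have hρδ : ρ ≤ δ := by
    have : 0 ≤ (α + β) * δ₀ := by positivity
    linarith
  -- rate-weakened right letters
  have hC₃ρ := hasMajorant_rate_mono (R := R) (H := H) blk (cV * α₁) (fun a => (g.len a ^ 2)⁻¹) hcVα hw2i hρδ hdnn hC₃
  have hP₁ρ := hasMajorant_rate_mono (R := R) (H := H) blk (κ₁ * α₁) (fun a => (g.len a ^ 2)⁻¹) hκ₁α hw2i hρδ hdnn hP₁
  have hP₂ρ := hasMajorant_rate_mono (R := R) (H := H) blk (κ₂ * α₁) (fun a => (g.len a ^ 2)⁻¹) hκ₂α hw2i hρδ hdnn hP₂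
  -- the words GC₃, GP₁, GP₂
  have w2 := hasMajorant_comp_decay (R := R) (H := H) blk d δ₀ α β ρ δ Λ B₀ (cV * α₁) (fun a => g.len a ^ 2)
    (fun a => (g.len a ^ 2)⁻¹) hw2 hw2i hΛ hB₀ hcVα hρ hr hdnn htri hT2i h261 hG hC₃ρ
  have w3 := hasMajorant_comp_decay (R := R) (H := H) blk d δ₀ α β ρ δ Λ B₀ (κ₁ * α₁) (fun a => g.len a ^ 2)
    (fun a => (g.len a ^ 2)⁻¹) hw2 hw2i hΛ hB₀ hκ₁α hρ hr hdnn htri hT2i h261 hG hP₁ρ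
  have w4 := hasMajorant_comp_decay (R := R) (H := H) blk d δ₀ α β ρ δ Λ B₀ (κ₂ * α₁) (fun a => g.len a ^ 2)
    (fun a => (g.len a ^ 2)⁻¹) hw2 hw2i hΛ hB₀ hκ₂α hρ hr hdnn htri hT2i h261 hG hP₂ρ
  -- the words (G∇♯_k)B_k, summed
  have w1k : ∀ k ∈ s, HasMajorant (g := toB6 g R H) blk (G * Dv k * B k)
      (fun a b => (cB k * α₁ * B₀ * Λ * c) * ((g.len a * (g.len a)⁻¹) * Real.exp (-(ρ * g.dist a b)))) := by
    intro k hk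
    have hBρ := hasMajorant_rate_mono (R := R) (H := H) blk (cB k * α₁) (fun a => (g.len a)⁻¹)
      (mul_nonneg (hcB k hk) hα₁) hw1i hρδ hdnn (hB k hk)
    have h := hasMajorant_comp_decay (R := R) (H := H) blk d δ₀ α β ρ δ Λ B₀ (cB k * α₁) (fun a => g.len a)
      (fun a => (g.len a)⁻¹) hw1 hw1i hΛ hB₀ (mul_nonneg (hcB k hk) hα₁) hρ hr hdnn htri hT1i h261 (hGDv k hk) hBρ
    exact hasMajorant_mono (g := toB6 g R H) blk h fun a b => le_of_eq (by rw [← hc_def]; ring)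
  have w1 := hasMajorant_sum_const (R := R) (H := H) blk s (fun k => cB k * α₁ * B₀ * Λ * c)
    (fun a b => (g.len a * (g.len a)⁻¹) * Real.exp (-(ρ * g.dist a b))) w1k
  have hsum' := hasMajorant_add (g := toB6 g R H) blk
    (hasMajorant_add (g := toB6 g R H) blk (hasMajorant_add (g := toB6 g R H) blk w1 w2) w3) w4
  have e : G * vTotal V₃ P₁ P₂ = (∑ k ∈ s, G * Dv k * B k) + G * C₃ + G * P₁ + G * P₂ := by
    rw [vTotal, hV₃div]
    simp only [mul_add, Finset.mul_sum, mul_assoc]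
  rw [e]
  refine hasMajorant_mono (g := toB6 g R H) blk hsum' fun a b => ?_
  have ha : g.len a ≠ 0 := (hlen a).ne'
  have h1 : g.len a * (g.len a)⁻¹ = 1 := mul_inv_cancel₀ ha
  have h2 : g.len a ^ 2 * (g.len a ^ 2)⁻¹ = 1 := mul_inv_cancel₀ (pow_ne_zero 2 ha)
  have hS : (∑ k ∈ s, cB k * α₁ * B₀ * Λ * c) ≤ cV * α₁ * B₀ * Λ * c := by
    rw [← Finset.sum_mul, ← Finset.sum_mul, ← Finset.sum_mul, ← Finset.sum_mul]
    have : 0 ≤ α₁ * B₀ * Λ * c := by positivity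
    have := mul_le_mul_of_nonneg_right hsum this
    nlinarith
  have hE : 0 ≤ Real.exp (-(ρ * g.dist a b)) := Real.exp_nonneg _
  simp only [kappa385]
  rw [h1, h2] at *
  nlinarith [mul_le_mul_of_nonneg_right hS hE]

/-- **`G(U)V(A) ≺ κ₃₈₅(c_V + Σc_K)·α₁·e^{−ρd}` from the GRADIENT form and the commutator letters, summed.**  Letters: `V₃ =
V⁰ + Σ_{k∈s} V¹_k∇_k` with `V⁰ ≺ c_Vα₁(Lʲη)⁻²e^{−δd}`, `V¹_k ≺ c_{1,k}α₁(Lʲη)⁻¹e^{−δd}`, `Σ_k c_{1,k} ≦ c_V` ((3.73)); commutators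
`[V¹_k, ∇_k] ≺ c_{K,k}α₁(Lʲη)⁻²e^{−δd}`, `c_{K,k} ≧ 0` ((3.37) sizes of the coefficient differences — on the concrete carrier
`B9Eq352DivForm.norm_commPart_le`); Theorem 3.3's entry for each product `G(U)∇_k` («we may always replace ∇_U by ∇*_U»);
`P₁`, `P₂`, `G` as in (3.85).  Proof: `divForm_of_gradForm_sum` + `hasMajorant_C₃_of_comm_sum` + `hasMajorant_GV_of_divForm_sum`
at `c_V + Σ_k c_{K,k}` for `c_V`.
[cite: Balaban1985BackgroundPropagators, (3.84)–(3.86) p.407 + (3.70)–(3.73) pp.404–405 + (3.37) p.396 + (3.77) p.406 + (3.83) p.407 + Thm 3.3 p.399 + (3.42) p.397 + p.398 (remarks); Balaban1984PropagatorsII, Lemma 2.1 p.234 + (2.52)–(2.55) p.232] -/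
theorem hasMajorant_GV_of_gradForm_comm_sum (blk : W → g.Site) (d : ℕ) (s : Finset K)
    (δ₀ δ α β ρ Λ B₀ cV κ₁ κ₂ α₁ : ℝ) (c1 cK : K → ℝ)
    (hB₀ : 0 ≤ B₀) (hcV : 0 ≤ cV) (hκ₁ : 0 ≤ κ₁) (hκ₂ : 0 ≤ κ₂) (hα₁ : 0 ≤ α₁) (hΛ : 0 ≤ Λ) (hρ : 0 ≤ ρ)
    (hα : 0 ≤ α) (hβ : 0 ≤ β) (hδ₀ : 0 ≤ δ₀) (hr : ρ + (α + β) * δ₀ ≤ δ)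
    (hc1 : ∀ k ∈ s, 0 ≤ c1 k) (hsum : ∑ k ∈ s, c1 k ≤ cV) (hcK : ∀ k ∈ s, 0 ≤ cK k)
    (hdnn : ∀ a b : g.Site, 0 ≤ g.dist a b) (htri : Triangle254 (toB6 g R H)) (hlen : ∀ y : g.Site, 0 < g.len y)
    (h261 : Ineq261 d (toB6 g R H) δ₀ β)
    (hT1i : ScaleTransfer g δ₀ α Λ (fun a => (g.len a)⁻¹)) (hT2i : ScaleTransfer g δ₀ α Λ (fun a => (g.len a ^ 2)⁻¹))
    {G V₃ V0 P₁ P₂ : Module.End ℝ (W → ℝ)} {V1 D : K → Module.End ℝ (W → ℝ)} (hV₃ : V₃ = V0 + ∑ k ∈ s, V1 k * D k)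
    (hV0 : HasMajorant (g := toB6 g R H) blk V0
      (fun a b => cV * α₁ * (g.len a ^ 2)⁻¹ * Real.exp (-(δ * g.dist a b))))
    (hV1 : ∀ k ∈ s, HasMajorant (g := toB6 g R H) blk (V1 k)
      (fun a b => c1 k * α₁ * (g.len a)⁻¹ * Real.exp (-(δ * g.dist a b))))
    (hComm : ∀ k ∈ s, HasMajorant (g := toB6 g R H) blk (V1 k * D k - D k * V1 k)
      (fun a b => cK k * α₁ * (g.len a ^ 2)⁻¹ * Real.exp (-(δ * g.dist a b))))
    (hP₁ : HasMajorant (g := toB6 g R H) blk P₁ (fun a b => κ₁ * α₁ * (g.len a ^ 2)⁻¹ * Real.exp (-(δ * g.dist a b))))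
    (hP₂ : HasMajorant (g := toB6 g R H) blk P₂ (fun a b => κ₂ * α₁ * (g.len a ^ 2)⁻¹ * Real.exp (-(δ * g.dist a b))))
    (hG : HasMajorant (g := toB6 g R H) blk G (fun a b => B₀ * g.len a ^ 2 * Real.exp (-(δ * g.dist a b))))
    (hGD : ∀ k ∈ s, HasMajorant (g := toB6 g R H) blk (G * D k)
      (fun a b => B₀ * g.len a * Real.exp (-(δ * g.dist a b)))) :
    HasMajorant (g := toB6 g R H) blk (G * vTotal V₃ P₁ P₂)
      (fun a b => kappa385 B₀ (cV + ∑ k ∈ s, cK k) κ₁ κ₂ Λ (B6.c1 d δ₀ β) * α₁ * Real.exp (-(ρ * g.dist a b))) := by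
  have hSK : 0 ≤ ∑ k ∈ s, cK k := Finset.sum_nonneg hcK
  have hcVK : 0 ≤ cV + ∑ k ∈ s, cK k := add_nonneg hcV hSK
  have hsum' : ∑ k ∈ s, c1 k ≤ cV + ∑ k ∈ s, cK k := hsum.trans (le_add_of_nonneg_right hSK)
  -- C₃ := V⁰ + Σ_k [V¹_k, ∇_k]
  have hC₃ := hasMajorant_C₃_of_comm_sum (R := R) (H := H) blk s δ cV α₁ cK hV0 hComm
  exact hasMajorant_GV_of_divForm_sum (R := R) (H := H) blk d s δ₀ δ α β ρ Λ B₀ (cV + ∑ k ∈ s, cK k) κ₁ κ₂ α₁ c1 hB₀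
    hcVK hκ₁ hκ₂ hα₁ hΛ hρ hα hβ hδ₀ hr hc1 hsum' hdnn htri hlen h261 hT1i hT2i (divForm_of_gradForm_sum s hV₃) hV1 hC₃
    hP₁ hP₂ hG hGD

end SumDevice

/-! ## §3  Theorem 3.4's `G`-part, entries (3.42)₁ and (3.42)₃, from the summed gradient form and the commutator letters -/

section Assembly

variable {g : B9.Geometry} [Fintype g.Site] {R : ℝ} {H : Prop} {W : Type} [Fintype W] [DecidableEq W] {K : Type}

/-- **Theorem 3.4, `G`-part, entries (3.42)₁ and (3.42)₃ for one and the same `G(U′U)` — from the PRINTED finite-sum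
gradient form plus one commutator letter per difference letter.**  The statement of
`B9Ineq386RightEntry.thm34_G_entries13_opForm_of_comm` with `V₃ = V⁰ + Σ_{k∈s} V¹_k∇_k` (`Σ_k c_{1,k} ≦ c_V`), `hComm`,
`hDG`, `hGD` per `k ∈ s`, and the constant `κ₃₈₅′ = kappa385 B₀ (c_V + Σ_k c_{K,k}) κ₁ κ₂ Λ c`: ∃ `G(U′U)`, the two-sided
inverse of `Δ_a(U′U) = B9Eq386Neumann.deltaA DsD′ Δp′ DRDs′ Qs′ a Q′`, with `G(U′U) ≺ B₀c₁(1 − κ₃₈₅′α₁c₁)⁻¹(Lʲη)²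
e^{−(1−α′)ρd}` and `G(U′U)∇* ≺ B₀Λ_ρ²c₁(1 − κ₃₈₅′α₁c₁)⁻¹Lʲη e^{−(1−3α′)ρd}`, one smallness condition `κ₃₈₅′α₁c₁ < 1`.
[cite: Balaban1985BackgroundPropagators, Thm 3.4 p.400 + (3.82)–(3.86) p.407 + (3.70)–(3.73) pp.404–405 + (3.37) p.396 + (3.27) p.395 + (3.42) p.397 + p.398 (remarks); Balaban1984PropagatorsII, (2.66) p.234 + Lemma 2.1 p.234] -/
theorem thm34_G_entries13_opForm_of_comm_sum (blk : W → g.Site) (d : ℕ) (s : Finset K)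
    (δ₀ δ α β ρ α' Λ Λρ B₀ cV κ₁ κ₂ α₁ : ℝ) (c1 cK : K → ℝ)
    (hB₀ : 0 ≤ B₀) (hcV : 0 ≤ cV) (hκ₁ : 0 ≤ κ₁) (hκ₂ : 0 ≤ κ₂) (hα₁ : 0 ≤ α₁) (hΛ : 0 ≤ Λ)
    (hΛρ : 0 ≤ Λρ) (hρ : 0 ≤ ρ) (hα : 0 ≤ α) (hβ : 0 ≤ β) (hδ₀ : 0 ≤ δ₀) (hr : ρ + (α + β) * δ₀ ≤ δ) (hα' : α' ≤ 1)
    (hα'ρ0 : 0 ≤ α' * ρ) (hα'ρ2 : 0 ≤ (1 - 2 * α') * ρ)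
    (hc1 : ∀ k ∈ s, 0 ≤ c1 k) (hsum : ∑ k ∈ s, c1 k ≤ cV) (hcK : ∀ k ∈ s, 0 ≤ cK k)
    (hdnn : ∀ a b : g.Site, 0 ≤ g.dist a b) (htri : Triangle254 (toB6 g R H)) (hrefl : ∀ y : g.Site, g.dist y y = 0)
    (hsym : ∀ y y' : g.Site, g.dist y y' = g.dist y' y) (hlen : ∀ y : g.Site, 0 < g.len y)
    (h261 : Ineq261 d (toB6 g R H) δ₀ β) (h261' : Ineq261 d (toB6 g R H) ρ α')
    (hT1 : ScaleTransfer g δ₀ α Λ (fun a => g.len a)) (hT2 : ScaleTransfer g δ₀ α Λ (fun a => g.len a ^ 2))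
    (hT1i : ScaleTransfer g δ₀ α Λ (fun a => (g.len a)⁻¹)) (hT2i : ScaleTransfer g δ₀ α Λ (fun a => (g.len a ^ 2)⁻¹))
    (hTρ : ScaleTransfer g ρ α' Λρ (fun a => g.len a))
    (hsmall : kappa385 B₀ (cV + ∑ k ∈ s, cK k) κ₁ κ₂ Λ (B6.c1 d δ₀ β) * α₁ * B6.c1 d ρ α' < 1)
    {G Ds V₃ V0 P₁ P₂ DsD DsD' Δp Δp' DRDs DRDs' Qs Qs' Q Q' a V₁ V₂ F₂ F₂s : Module.End ℝ (W → ℝ)}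
    {V1 D : K → Module.End ℝ (W → ℝ)}
    (hV₃ : V₃ = V0 + ∑ k ∈ s, V1 k * D k) (hV₃' : V₃ = B9Eq386Neumann.vThree V₁ V₂ Δp Δp')
    (h371 : DsD' = DsD - V₁) (h376 : DRDs' = DRDs - V₂ - P₁) (h380 : Q' = Q + F₂) (h380s : Qs' = Qs + F₂s)
    (hP₂def : P₂ = pTwo Qs Q F₂ F₂s a)
    (hΔG : B9Eq386Neumann.deltaA DsD Δp DRDs Qs a Q * G = 1) (hGΔ : G * B9Eq386Neumann.deltaA DsD Δp DRDs Qs a Q = 1)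
    (hV0 : HasMajorant (g := toB6 g R H) blk V0
      (fun a b => cV * α₁ * (g.len a ^ 2)⁻¹ * Real.exp (-(δ * g.dist a b))))
    (hV1 : ∀ k ∈ s, HasMajorant (g := toB6 g R H) blk (V1 k)
      (fun a b => c1 k * α₁ * (g.len a)⁻¹ * Real.exp (-(δ * g.dist a b))))
    (hComm : ∀ k ∈ s, HasMajorant (g := toB6 g R H) blk (V1 k * D k - D k * V1 k)
      (fun a b => cK k * α₁ * (g.len a ^ 2)⁻¹ * Real.exp (-(δ * g.dist a b))))
    (hP₁ : HasMajorant (g := toB6 g R H) blk P₁ (fun a b => κ₁ * α₁ * (g.len a ^ 2)⁻¹ * Real.exp (-(δ * g.dist a b))))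
    (hP₂ : HasMajorant (g := toB6 g R H) blk P₂ (fun a b => κ₂ * α₁ * (g.len a ^ 2)⁻¹ * Real.exp (-(δ * g.dist a b))))
    (hG : HasMajorant (g := toB6 g R H) blk G (fun a b => B₀ * g.len a ^ 2 * Real.exp (-(δ * g.dist a b))))
    (hDG : ∀ k ∈ s, HasMajorant (g := toB6 g R H) blk (D k * G)
      (fun a b => B₀ * g.len a * Real.exp (-(δ * g.dist a b))))
    (hGD : ∀ k ∈ s, HasMajorant (g := toB6 g R H) blk (G * D k)
      (fun a b => B₀ * g.len a * Real.exp (-(δ * g.dist a b))))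
    (hGDs : HasMajorant (g := toB6 g R H) blk (G * Ds) (fun a b => B₀ * g.len a * Real.exp (-(δ * g.dist a b)))) :
    ∃ GExt : Module.End ℝ (W → ℝ),
      B9Eq386Neumann.deltaA DsD' Δp' DRDs' Qs' a Q' * GExt = 1 ∧ GExt * B9Eq386Neumann.deltaA DsD' Δp' DRDs' Qs' a Q' = 1 ∧
      HasMajorant (g := toB6 g R H) blk GExt
        (fun a b => B₀ * B6.c1 d ρ α' *
          (1 - kappa385 B₀ (cV + ∑ k ∈ s, cK k) κ₁ κ₂ Λ (B6.c1 d δ₀ β) * α₁ * B6.c1 d ρ α')⁻¹ *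
          g.len a ^ 2 * Real.exp (-((1 - α') * ρ * g.dist a b))) ∧
      HasMajorant (g := toB6 g R H) blk (GExt * Ds)
        (fun a b => B₀ * Λρ ^ 2 * B6.c1 d ρ α' *
          (1 - kappa385 B₀ (cV + ∑ k ∈ s, cK k) κ₁ κ₂ Λ (B6.c1 d δ₀ β) * α₁ * B6.c1 d ρ α')⁻¹ *
          g.len a * Real.exp (-((1 - 3 * α') * ρ * g.dist a b))) := by
  have hSK : 0 ≤ ∑ k ∈ s, cK k := Finset.sum_nonneg hcK
  have hcVK : 0 ≤ cV + ∑ k ∈ s, cK k := add_nonneg hcV hSK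
  have hsum' : ∑ k ∈ s, c1 k ≤ cV + ∑ k ∈ s, cK k := hsum.trans (le_add_of_nonneg_right hSK)
  -- the (3.73) letter V⁰ at the weakened constant c_V + Σc_K
  have hV0' : HasMajorant (g := toB6 g R H) blk V0
      (fun a b => (cV + ∑ k ∈ s, cK k) * α₁ * (g.len a ^ 2)⁻¹ * Real.exp (-(δ * g.dist a b))) := by
    refine hasMajorant_mono (g := toB6 g R H) blk hV0 fun a b => ?_
    have hw : 0 ≤ α₁ * (g.len a ^ 2)⁻¹ * Real.exp (-(δ * g.dist a b)) :=
      mul_nonneg (mul_nonneg hα₁ (inv_nonneg.mpr (sq_nonneg _))) (Real.exp_nonneg _)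
    nlinarith
  -- (3.85), summed (right composite)
  have h385 := ineq385_op_sum (R := R) (H := H) blk d s δ₀ δ α β ρ Λ B₀ (cV + ∑ k ∈ s, cK k) κ₁ κ₂ α₁ c1 hB₀ hcVK
    hκ₁ hκ₂ hα₁ hΛ hρ hα hβ hδ₀ hr hc1 hsum' hdnn htri hlen h261 hT1 hT2 hV₃ hV0' hV1 hP₁ hP₂ hG hDG
  -- the left composite from the gradient form and the commutators
  have hGV := hasMajorant_GV_of_gradForm_comm_sum (R := R) (H := H) blk d s δ₀ δ α β ρ Λ B₀ cV κ₁ κ₂ α₁ c1 cK hB₀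
    hcV hκ₁ hκ₂ hα₁ hΛ hρ hα hβ hδ₀ hr hc1 hsum hcK hdnn htri hlen h261 hT1i hT2i hV₃ hV0 hV1 hComm hP₁ hP₂ hG hGD
  have hθ : 0 ≤ kappa385 B₀ (cV + ∑ k ∈ s, cK k) κ₁ κ₂ Λ (B6.c1 d δ₀ β) * α₁ :=
    mul_nonneg (kappa385_nonneg hB₀ hcVK hκ₁ hκ₂ hΛ (B6RandomWalk.c1_nonneg d δ₀ β)) hα₁
  have hα'ρ : 0 ≤ (1 - α') * ρ := by nlinarith
  -- (3.84): Δ_a(U′U) = Δ_a(U) − V(A)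
  have h384 : B9Eq386Neumann.deltaA DsD' Δp' DRDs' Qs' a Q' =
      B9Eq386Neumann.deltaA DsD Δp DRDs Qs a Q - vTotal V₃ P₁ P₂ := by
    rw [B9Eq386Neumann.eq384_sub DsD DsD' Δp Δp' DRDs DRDs' Qs Qs' Q Q' a V₁ V₂ P₁ F₂ F₂s h371 h376 h380 h380s,
      hV₃', hP₂def]
  -- (3.86): existence with both resolvent identities and the inverse property
  obtain ⟨GExt, h386L, h386, hL, hR⟩ := B9Eq360Vprime.exists_gPrimeExt_of_363 (g := toB6 g R H) blk d ρ α' _ hθ hα'ρ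
    hdnn h261' hsmall (B9Eq386Neumann.deltaA DsD Δp DRDs Qs a Q) G (vTotal V₃ P₁ P₂) hΔG hGΔ h385
  have hρδ : ρ ≤ δ := by
    have : 0 ≤ (α + β) * δ₀ := by positivity
    linarith
  refine ⟨GExt, ?_, ?_, ?_, ?_⟩
  · rw [h384]; exact hL
  · rw [h384]; exact hR
  · have hGρ := hasMajorant_rate_mono (R := R) (H := H) blk B₀ (fun a => g.len a ^ 2) hB₀ (fun a => sq_nonneg _) hρδ
      hdnn hG
    exact gExt_entry1_of_386 (R := R) (H := H) blk d ρ α' _ B₀ (fun a => g.len a ^ 2) hB₀ (fun a => sq_nonneg _) hθ hρ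
      hα' hα'ρ htri hrefl hdnn h261' hsmall hGρ h385 h386
  · have hGDsρ := hasMajorant_rate_mono (R := R) (H := H) blk B₀ (fun a => g.len a) hB₀ (fun a => (hlen a).le) hρδ
      hdnn hGDs
    exact gExt_rightEntry_of_386L (R := R) (H := H) blk d ρ α' _ B₀ Λρ (fun a => g.len a) hB₀ hΛρ
      (fun a => (hlen a).le) hθ hρ hα' hα'ρ0 hα'ρ2 htri hrefl hsym hdnn h261' hsmall hTρ hGDsρ hGV h386L

end Assembly

end Literature.MathematicalPhysics.QuantumFieldTheory.Balaban1983to89.B9Ineq386CommSum
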